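import Summits.CriticalPhenomena.PercolationContinuityZ3.Theorems.PercNearOneGluingNoHeavyLowerTailTwoCopyTwoWeightBridge
import Summits.CriticalPhenomena.PercolationContinuityZ3.Theorems.PercNearOneGluingNoHeavyLowerTailNineTypeTwoMapCount
import Summits.CriticalPhenomena.PercolationContinuityZ3.Theorems.PercNearOneGluingNoHeavyLowerTailQ44bRowCells
import Summits.CriticalPhenomena.PercolationContinuityZ3.Theorems.PercNearOneGluingNoHeavyLowerTailQ44bMixedInternal

/-!
# Two-weight monotone `Q44b` (`bil w w' ≥ 0` for `w' ≤ w`), `B₁₀(e) ≥ 0` and `MIX(e) = B₀₁ + B₁₀ ≥ 0` at EVERY pair (all `n`)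

Support file for crux `stmt-CriticalPhenomena-4575` (quadratic four-point row `Q44b` and its pencil / two-weight companions), seat `prim-l12-p6`
gen 19; memos `run/shared/lean/prim/prim-l12/FROM-prim-l12-p6-g14-OTA-KERNEL-AND-COMB3.md` §1(c) and `FROM-prim-l12-p6-g19-TWO-WEIGHT-KERNEL.md`.
`Q44b ∀n` is kernel (`Q44b.row_nonneg_all`, prim-bnk-1 g19).  The ORIENTED two-map count `TwoCopyMono.twoMap_sum_kerS_nonneg` (gen 14) and the
two-weight fibre bridge `…TwoCopyTwoWeightBridge` (gen 19) give the law-level companions that were so far on paper (gen-14 memo §1(c);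
INEQ-CLAIMS rows 'two-weight monotonicity', 'B10 ≥ 0 every edge type', 'MIX ≥ 0'):
* `TwoCopyMono.kerS_twoMap_prof` (every nine-type kernel has the two-map property), `sum_kerS_cell₂`, `q44b_pack_twoWeight` (two-weight packing
  `Σ_{θ∈S} cell_w(h θ)·cell_{w'}(l θ) ≤ (cell_w(ab|cy)+cell_w(abcy))·cell_{w'}(a|b|c|y)` for `w' ≤ w`, heavy cells at the bigger weights);
  `fibreCount_nonneg`, `mix_eq_fibres`, `mix_cell_nonneg` (the symmetrised mixed form at a pair `e` is the ONE-map count on the fibres through `e`).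
* **`Q44b.bil_nonneg_of_le`** — TWO-WEIGHT MONOTONE `Q44b`: for all `n`, `a b c y` and weightings `w' ≤ w` of the pairs of `Fin n`,
  `0 ≤ Q44b.bil w w' a b c y = P_w(AC)P_{w'}(∅) − P_w(AΔ)P_{w'}(X) − P_w(ab|c|y)P_{w'}(C¬A) − P_w(a|bcy)P_{w'}(X′)` (`bil_eq_cells`: cell form).
  The orientation matters: with the slots exchanged the form is negative on 786 of 1 200 random exact instances (memo).
* **`Q44b.bigFirst_nonneg`** — `B₁₀(e) = bil (w[e↦1]) (w[e↦0]) ≥ 0` at EVERY pair `e` (ttrl3 MIX-SECTORS (ii): 0 / 2.4·10⁹; now kernel).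
* **`Q44b.mix_nonneg`** — `MIX(e) = bil (w[e↦0]) (w[e↦1]) + bil (w[e↦1]) (w[e↦0]) ≥ 0` at EVERY pair (MIX-SECTORS: 0 / 17.1·10⁹; now kernel); hence
  `pencilMixed_holds`, **`mixAny_holds`, `mixa_holds`, `mixInt_holds`** — the hypotheses `MIXany`/`MIXa` (gen 8) and `MIXint` (gen 12) of
  `row_nonneg_of_mixedAny/_of_mixedAt/_of_mixInt` are DISCHARGED (`row_nonneg_via_mix`: the pencil route to `Q44b ∀n` closes unconditionally).
No named facts, no sorries, no new definitions.
-/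

noncomputable section

namespace Summit.CriticalPhenomena.PercolationContinuityZ3.Theorems

open MeasureTheory Set Finset Literature.Probability.Percolation
open Literature.Probability.LatticeModels (prodBernoulli)
open Summit.CriticalPhenomena.PercolationContinuityZ3.Cruxes.AdditiveGluing.TieLine.ConnAtoms

namespace TwoCopyMono

open FourPointAtoms

variable {n : ℕ}

/-- **Every nine-type kernel has the two-map property** (the oriented two-map count `twoMap_sum_kerS_nonneg` in profile language).
[this work] -/
theorem kerS_twoMap_prof (S : Finset ℕ) (hS : ∀ θ ∈ S, 1 ≤ θ ∧ θ ≤ 9) :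
    (∀ (γ : Type) [Fintype γ] [DecidableEq γ] (τ σ : Finset γ → Prof),
      (∀ S T : Finset γ, S ⊆ T → ProfLE (τ S) (τ T)) → (∀ S T : Finset γ, S ⊆ T → ProfLE (σ S) (σ T)) →
      (∀ T : Finset γ, ProfLE (σ T) (τ T)) → (∀ T : Finset γ, IsEqv (τ T)) → (∀ T : Finset γ, IsEqv (σ T)) →
        0 ≤ ∑ T : Finset γ, liftK (kerS S) (τ T) (σ Tᶜ)) := by
  classical
  intro γ _ _ τ σ hτ hσ hστ hτe hσe
  have hexτ : ∀ T : Finset γ, ∃ i : Fin 15, τ T = pp i := fun T => exists_pat_of_isEqv (hτe T)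
  have hexσ : ∀ T : Finset γ, ∃ i : Fin 15, σ T = pp i := fun T => exists_pat_of_isEqv (hσe T)
  choose ιτ hιτ using hexτ
  choose ισ hισ using hexσ
  have hτ' : ∀ A B : Finset γ, A ⊆ B → ple (ιτ A) (ιτ B) = true := by
    intro A B hAB; apply ple_of_profLE; rw [← hιτ A, ← hιτ B]; exact hτ A B hAB
  have hσ' : ∀ A B : Finset γ, A ⊆ B → ple (ισ A) (ισ B) = true := by
    intro A B hAB; apply ple_of_profLE; rw [← hισ A, ← hισ B]; exact hσ A B hAB
  have hστ' : ∀ A : Finset γ, ple (ισ A) (ιτ A) = true := by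
    intro A; apply ple_of_profLE; rw [← hισ A, ← hιτ A]; exact hστ A
  have h := twoMap_sum_kerS_nonneg S hS ιτ ισ hτ' hσ' hστ'
  have heq : (∑ T : Finset γ, liftK (kerS S) (τ T) (σ Tᶜ)) = ∑ T : Finset γ, kerS S (ιτ T) (ισ Tᶜ) := by
    refine Finset.sum_congr rfl fun T _ => ?_
    rw [hιτ T, hισ Tᶜ, liftK_pp]
  rw [heq]; exact h

/-- Evaluation of the two-weight nine-type form: `Σ_{i,j} kerS S i j · cᵢ · dⱼ = (c₁₁ + c₁₄)·d₀ − Σ_{θ∈S} c_{h θ}·d_{l θ}`. [this work] -/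
theorem sum_kerS_cell₂ (S : Finset ℕ) (hS : ∀ θ ∈ S, 1 ≤ θ ∧ θ ≤ 9) (c d : Fin 15 → ℝ) :
    (∑ i : Fin 15, ∑ j : Fin 15, (kerS S i j : ℝ) * c i * d j) =
      (c 11 + c 14) * d 0 - ∑ θ ∈ S, c (hIdx θ) * d (lIdx θ) := by
  classical
  have hsplit : ∀ i j : Fin 15, (kerS S i j : ℝ) * c i * d j =
      (if isAC i ∧ j = 0 then c i * d j else 0) - (if badS S i j then c i * d j else 0) := by
    intro i j; unfold kerS; push_cast; split_ifs <;> ring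
  simp_rw [hsplit, Finset.sum_sub_distrib]
  congr 1
  · have h0 : ∀ i : Fin 15, (∑ j : Fin 15, if isAC i ∧ j = 0 then c i * d j else 0) = if isAC i then c i * d 0 else 0 := by
      intro i
      by_cases hi : isAC i
      · rw [if_pos hi, Finset.sum_eq_single (0 : Fin 15)]
        · rw [if_pos ⟨hi, rfl⟩]
        · intro j _ hj; rw [if_neg]; rintro ⟨_, h⟩; exact hj h
        · intro h; exact absurd (Finset.mem_univ _) h
      · rw [if_neg hi]; exact Finset.sum_eq_zero fun j _ => by rw [if_neg]; rintro ⟨h, _⟩; exact hi h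
    simp_rw [h0]
    rw [Finset.sum_ite, Finset.sum_const_zero, add_zero]
    have hf : (Finset.univ.filter fun i : Fin 15 => isAC i) = {11, 14} := by decide
    rw [hf, Finset.sum_pair (by decide)]; ring
  · have hinj : Set.InjOn (fun θ => (hIdx θ, lIdx θ)) (S : Set ℕ) := by
      intro θ hθ θ' hθ' h
      simp only [Prod.mk.injEq] at h
      exact type_unique θ (Finset.mem_Icc.2 (hS θ hθ)) θ' (Finset.mem_Icc.2 (hS θ' hθ')) h.1 h.2
    rw [← Finset.sum_image (f := fun p : Fin 15 × Fin 15 => c p.1 * d p.2) hinj]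
    rw [← Finset.sum_product' (f := fun i j => if badS S i j then c i * d j else 0)]
    rw [← Finset.sum_filter]
    congr 1
    ext p
    simp only [Finset.mem_filter, Finset.mem_product, Finset.mem_univ, true_and, Finset.mem_image, badS]
    constructor
    · rintro ⟨θ, hθ, h1, h2⟩; exact ⟨θ, hθ, Prod.ext h1 h2⟩
    · rintro ⟨θ, hθ, h⟩; exact ⟨θ, hθ, (congrArg Prod.fst h), (congrArg Prod.snd h)⟩

/-- **Two-weight packing of any set of types.**  For every `S ⊆ {1,…,9}`, every finite weighted graph with two weightings
`w' ≤ w` and all marked points: `Σ_{θ∈S} cell_w(h θ)·cell_{w'}(l θ) ≤ (cell_w(ab|cy) + cell_w(abcy))·cell_{w'}(a|b|c|y)`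
(heavy cells at the bigger weights). [this work] -/
theorem q44b_pack_twoWeight (S : Finset ℕ) (hS : ∀ θ ∈ S, 1 ≤ θ ∧ θ ≤ 9)
    (w w' : Sym2 (Fin n) → unitInterval) (hle : ∀ e, w' e ≤ w e) (a b c y : Fin n) :
    ∑ θ ∈ S, cell w a b c y (hIdx θ) * cell w' a b c y (lIdx θ) ≤
      (cell w a b c y 11 + cell w a b c y 14) * cell w' a b c y 0 := by
  have h := sum_kernel_cell₂_nonneg (kerS_twoMap_prof S hS) w w' hle a b c y
  rw [sum_kerS_cell₂ S hS] at h
  linarith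


/-! ## The two-map fibre count; the mixed Bernstein coefficient as a one-map fibre sum -/

/-- **The two-map fibre count is nonnegative**: for a kernel with the two-map property and any `C F D`,
`0 ≤ Σ_{T ⊆ D} κ(prof(C ∪ (F ∪ T)), prof(C ∪ (D ∖ T)))` (the maps `T ↦ prof(C ∪ F ∪ T) ≥ T ↦ prof(C ∪ T)` on the subsets of `D`).
[this work] -/
theorem fibreCount_nonneg {κ : Fin 15 → Fin 15 → ℤ}
    (hκ : (∀ (γ : Type) [Fintype γ] [DecidableEq γ] (τ σ : Finset γ → Prof),
      (∀ S T : Finset γ, S ⊆ T → ProfLE (τ S) (τ T)) → (∀ S T : Finset γ, S ⊆ T → ProfLE (σ S) (σ T)) →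
      (∀ T : Finset γ, ProfLE (σ T) (τ T)) → (∀ T : Finset γ, IsEqv (τ T)) → (∀ T : Finset γ, IsEqv (σ T)) →
        0 ≤ ∑ T : Finset γ, liftK κ (τ T) (σ Tᶜ)))
    (a b c y : Fin n) (C F D : Finset (Sym2 (Fin n))) :
    0 ≤ ∑ T ∈ D.powerset, liftK κ (prof a b c y ↑(C ∪ (F ∪ T))) (prof a b c y ↑(C ∪ (D \ T))) := by
  classical
  let emb : Finset ↥D → Finset (Sym2 (Fin n)) := fun T => T.map (Function.Embedding.subtype _)
  let τ : Finset ↥D → Prof := fun T => prof a b c y ↑(C ∪ (F ∪ emb T))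
  let σ : Finset ↥D → Prof := fun T => prof a b c y ↑(C ∪ emb T)
  have hemb : ∀ S T : Finset ↥D, S ⊆ T → emb S ⊆ emb T := by
    intro S T hST e he
    simp only [emb, Finset.mem_map, Function.Embedding.coe_subtype] at he ⊢
    obtain ⟨x, hx, rfl⟩ := he
    exact ⟨x, hST hx, rfl⟩
  have hτ : ∀ S T : Finset ↥D, S ⊆ T → ProfLE (τ S) (τ T) := by
    intro S T hST
    apply prof_mono
    intro e he
    simp only [Finset.coe_union, Set.mem_union, Finset.mem_coe] at he ⊢
    rcases he with he | he | he
    · exact Or.inl he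
    · exact Or.inr (Or.inl he)
    · exact Or.inr (Or.inr (hemb S T hST he))
  have hσ : ∀ S T : Finset ↥D, S ⊆ T → ProfLE (σ S) (σ T) := by
    intro S T hST
    apply prof_mono
    intro e he
    simp only [Finset.coe_union, Set.mem_union, Finset.mem_coe] at he ⊢
    rcases he with he | he
    · exact Or.inl he
    · exact Or.inr (hemb S T hST he)
  have hστ : ∀ T : Finset ↥D, ProfLE (σ T) (τ T) := by
    intro T
    apply prof_mono
    intro e he
    simp only [Finset.coe_union, Set.mem_union, Finset.mem_coe] at he ⊢
    rcases he with he | he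
    · exact Or.inl he
    · exact Or.inr (Or.inr he)
  have hτe : ∀ T : Finset ↥D, IsEqv (τ T) := fun T => prof_isEqv a b c y _
  have hσe : ∀ T : Finset ↥D, IsEqv (σ T) := fun T => prof_isEqv a b c y _
  have hgood := hκ (↥D) τ σ hτ hσ hστ hτe hσe
  have hre : (∑ T : Finset ↥D, liftK κ (τ T) (σ Tᶜ)) =
      ∑ T ∈ D.powerset, liftK κ (prof a b c y ↑(C ∪ (F ∪ T))) (prof a b c y ↑(C ∪ (D \ T))) := by
    refine Finset.sum_bij' (fun T _ => emb T) (fun T _ => T.subtype (· ∈ D)) ?_ ?_ ?_ ?_ ?_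
    · intro T _
      rw [Finset.mem_powerset]
      intro e he
      simp only [emb, Finset.mem_map, Function.Embedding.coe_subtype] at he
      obtain ⟨x, _, rfl⟩ := he
      exact x.2
    · intro T _; exact Finset.mem_univ _
    · intro T _
      ext x
      simp [emb]
    · intro T hT
      rw [Finset.mem_powerset] at hT
      simp only [emb, Finset.subtype_map]
      exact Finset.filter_true_of_mem fun e he => hT he
    · intro T _
      have h1 : emb Tᶜ = D \ emb T := by
        ext e
        simp only [emb, Finset.mem_map, Function.Embedding.coe_subtype, Finset.mem_sdiff, Finset.mem_compl]
        constructor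
        · rintro ⟨x, hx, rfl⟩
          exact ⟨x.2, fun ⟨x', hx', he⟩ => hx (by rwa [Subtype.ext he] at hx')⟩
        · rintro ⟨heM, hne⟩
          exact ⟨⟨e, heM⟩, fun h => hne ⟨⟨e, heM⟩, h, rfl⟩, rfl⟩
      show liftK κ (τ T) (σ Tᶜ) = _
      simp only [τ, σ]
      rw [h1]
  rw [hre] at hgood
  exact hgood

/-- Weight of a configuration under a weighting updated at one coordinate. [this work] -/
theorem wt_update (w : Sym2 (Fin n) → unitInterval) (e : Sym2 (Fin n)) (t : unitInterval) (S : Finset (Sym2 (Fin n))) :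
    wt (Function.update w e t) S =
      (if e ∈ S then (t : ℝ) else 1 - (t : ℝ)) * (∏ f ∈ Finset.univ.erase e, (if f ∈ S then (w f : ℝ) else 1 - (w f : ℝ))) := by
  unfold wt
  rw [← Finset.mul_prod_erase Finset.univ _ (Finset.mem_univ e)]
  congr 1
  · simp only [Function.update_self]
  · refine Finset.prod_congr rfl fun f hf => ?_
    rw [Function.update_of_ne (Finset.ne_of_mem_erase hf)]

/-- The symmetrised mixed two-weight form (`w[e↦0]` against `w[e↦1]` plus `w[e↦1]` against `w[e↦0]`) as a sum over pairs of
configurations: exactly one of the two configurations contains `e`, the other coordinates carry the weights of `w`. [this work] -/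
theorem mix_eq_pairs (κ : Fin 15 → Fin 15 → ℤ) (w : Sym2 (Fin n) → unitInterval) (e : Sym2 (Fin n)) (a b c y : Fin n) :
    ((∑ i : Fin 15, ∑ j : Fin 15, (κ i j : ℝ) * cell (Function.update w e 0) a b c y i * cell (Function.update w e 1) a b c y j) +
      ∑ i : Fin 15, ∑ j : Fin 15, (κ i j : ℝ) * cell (Function.update w e 1) a b c y i * cell (Function.update w e 0) a b c y j) =
      ∑ S : Finset (Sym2 (Fin n)), ∑ S' : Finset (Sym2 (Fin n)),
        (liftK κ (prof a b c y ↑S) (prof a b c y ↑S') : ℝ) *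
          (((if e ∈ S then (0 : ℝ) else 1) * (if e ∈ S' then (1 : ℝ) else 0) +
          (if e ∈ S then (1 : ℝ) else 0) * (if e ∈ S' then (0 : ℝ) else 1)) *
          ((∏ f ∈ Finset.univ.erase e, (if f ∈ S then (w f : ℝ) else 1 - (w f : ℝ))) * (∏ f ∈ Finset.univ.erase e, (if f ∈ S' then (w f : ℝ) else 1 - (w f : ℝ))))) := by
  rw [sum_kernel_cell₂_eq_pairs, sum_kernel_cell₂_eq_pairs, ← Finset.sum_add_distrib]
  refine Finset.sum_congr rfl fun S _ => ?_
  rw [← Finset.sum_add_distrib]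
  refine Finset.sum_congr rfl fun S' _ => ?_
  rw [wt_update, wt_update, wt_update, wt_update]
  simp only [Set.Icc.coe_zero, Set.Icc.coe_one]
  ring

/-- On the fibre `(M, C)` at `T ⊆ M`: exactly one of `C ∪ T`, `C ∪ (M ∖ T)` contains `e` iff `e ∈ M`. [this work] -/
theorem mixInd_fibre (e : Sym2 (Fin n)) {M C T : Finset (Sym2 (Fin n))} (hT : T ⊆ M) (hCM : Disjoint C M) :
    ((if e ∈ C ∪ T then (0 : ℝ) else 1) * (if e ∈ C ∪ (M \ T) then (1 : ℝ) else 0) +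
          (if e ∈ C ∪ T then (1 : ℝ) else 0) * (if e ∈ C ∪ (M \ T) then (0 : ℝ) else 1)) = if e ∈ M then (1 : ℝ) else 0 := by
  by_cases hC : e ∈ C
  · have hM : e ∉ M := fun h => (Finset.disjoint_left.1 hCM hC) h
    have h1 : e ∈ C ∪ T := Finset.mem_union_left _ hC
    have h2 : e ∈ C ∪ (M \ T) := Finset.mem_union_left _ hC
    simp [h1, h2, hM]
  · by_cases hTe : e ∈ T
    · have h1 : e ∈ C ∪ T := Finset.mem_union_right _ hTe
      have h2 : e ∉ C ∪ (M \ T) := by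
        rw [Finset.mem_union, not_or, Finset.mem_sdiff, not_and, not_not]; exact ⟨hC, fun _ => hTe⟩
      simp [h1, h2, hT hTe]
    · have h1 : e ∉ C ∪ T := by rw [Finset.mem_union, not_or]; exact ⟨hC, hTe⟩
      by_cases hM : e ∈ M
      · have h2 : e ∈ C ∪ (M \ T) := Finset.mem_union_right _ (Finset.mem_sdiff.2 ⟨hM, hTe⟩)
        simp [h1, h2, hM]
      · have h2 : e ∉ C ∪ (M \ T) := by
          rw [Finset.mem_union, not_or, Finset.mem_sdiff, not_and]; exact ⟨hC, fun h => absurd h hM⟩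
        simp [h1, h2, hM]

/-- On the fibre `(M, C)` the product of the two reduced weights (coordinate `e` removed) does not depend on `T`. [this work] -/
theorem wt_erase_pair_eq (w : Sym2 (Fin n) → unitInterval) (e : Sym2 (Fin n)) {M C T : Finset (Sym2 (Fin n))} (hT : T ⊆ M) :
    (∏ f ∈ Finset.univ.erase e, (if f ∈ C ∪ T then (w f : ℝ) else 1 - (w f : ℝ))) * (∏ f ∈ Finset.univ.erase e, (if f ∈ C ∪ (M \ T) then (w f : ℝ) else 1 - (w f : ℝ))) =
      (∏ f ∈ Finset.univ.erase e, (if f ∈ C then (w f : ℝ) * (w f : ℝ) else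
        if f ∈ M then (w f : ℝ) * (1 - (w f : ℝ)) else (1 - (w f : ℝ)) * (1 - (w f : ℝ)))) := by
  rw [← Finset.prod_mul_distrib]
  refine Finset.prod_congr rfl fun f _ => ?_
  by_cases hC : f ∈ C
  · rw [if_pos (Finset.mem_union_left _ hC), if_pos (Finset.mem_union_left _ hC), if_pos hC]
  · by_cases hTf : f ∈ T
    · have h1 : f ∈ C ∪ T := Finset.mem_union_right _ hTf
      have h2 : f ∉ C ∪ (M \ T) := by
        rw [Finset.mem_union, not_or, Finset.mem_sdiff, not_and, not_not]; exact ⟨hC, fun _ => hTf⟩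
      rw [if_pos h1, if_neg h2, if_neg hC, if_pos (hT hTf)]
    · have h1 : f ∉ C ∪ T := by rw [Finset.mem_union, not_or]; exact ⟨hC, hTf⟩
      by_cases hM : f ∈ M
      · have h2 : f ∈ C ∪ (M \ T) := Finset.mem_union_right _ (Finset.mem_sdiff.2 ⟨hM, hTf⟩)
        rw [if_neg h1, if_pos h2, if_neg hC, if_pos hM]; ring
      · have h2 : f ∉ C ∪ (M \ T) := by
          rw [Finset.mem_union, not_or, Finset.mem_sdiff, not_and]; exact ⟨hC, fun h => absurd h hM⟩
        rw [if_neg h1, if_neg h2, if_neg hC, if_neg hM]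

/-- **The mixed coefficient as a ONE-map fibre sum**: the symmetrised mixed two-weight form at the pair `e` equals
`Σ_{M ∋ e} Σ_{C ⊆ Mᶜ} W⁻(M,C) · Σ_{T ⊆ M} κ(prof(C∪T), prof(C∪(M∖T)))` — the antipodal count on the fibres through `e`, with the weight
of the coordinate `e` removed (`W⁻ ≥ 0`). [this work] -/
theorem mix_eq_fibres (κ : Fin 15 → Fin 15 → ℤ) (w : Sym2 (Fin n) → unitInterval) (e : Sym2 (Fin n)) (a b c y : Fin n) :
    ((∑ i : Fin 15, ∑ j : Fin 15, (κ i j : ℝ) * cell (Function.update w e 0) a b c y i * cell (Function.update w e 1) a b c y j) +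
      ∑ i : Fin 15, ∑ j : Fin 15, (κ i j : ℝ) * cell (Function.update w e 1) a b c y i * cell (Function.update w e 0) a b c y j) =
      ∑ M : Finset (Sym2 (Fin n)), ∑ C ∈ (Mᶜ).powerset, (if e ∈ M then (1 : ℝ) else 0) *
        (∏ f ∈ Finset.univ.erase e, (if f ∈ C then (w f : ℝ) * (w f : ℝ) else
        if f ∈ M then (w f : ℝ) * (1 - (w f : ℝ)) else (1 - (w f : ℝ)) * (1 - (w f : ℝ)))) *
          ∑ T ∈ M.powerset, (liftK κ (prof a b c y ↑(C ∪ T)) (prof a b c y ↑(C ∪ (M \ T))) : ℝ) := by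
  classical
  rw [mix_eq_pairs, sum_pairs_eq_sum_fibres]
  refine Finset.sum_congr rfl fun M _ => Finset.sum_congr rfl fun C hC => ?_
  rw [Finset.mem_powerset] at hC
  have hCM : Disjoint C M := by
    rw [Finset.disjoint_left]; intro f hfC hfM; exact (Finset.mem_compl.1 (hC hfC)) hfM
  rw [Finset.mul_sum]
  refine Finset.sum_congr rfl fun T hT => ?_
  rw [Finset.mem_powerset] at hT
  rw [mixInd_fibre e hT hCM, wt_erase_pair_eq w e hT]
  ring

/-- **The symmetrised mixed two-weight form is nonnegative** for every kernel with the two-map property, at every pair `e`. [this work] -/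
theorem mix_cell_nonneg {κ : Fin 15 → Fin 15 → ℤ}
    (hκ : (∀ (γ : Type) [Fintype γ] [DecidableEq γ] (τ σ : Finset γ → Prof),
      (∀ S T : Finset γ, S ⊆ T → ProfLE (τ S) (τ T)) → (∀ S T : Finset γ, S ⊆ T → ProfLE (σ S) (σ T)) →
      (∀ T : Finset γ, ProfLE (σ T) (τ T)) → (∀ T : Finset γ, IsEqv (τ T)) → (∀ T : Finset γ, IsEqv (σ T)) →
        0 ≤ ∑ T : Finset γ, liftK κ (τ T) (σ Tᶜ)))
    (w : Sym2 (Fin n) → unitInterval) (e : Sym2 (Fin n)) (a b c y : Fin n) :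
    0 ≤ ((∑ i : Fin 15, ∑ j : Fin 15, (κ i j : ℝ) * cell (Function.update w e 0) a b c y i * cell (Function.update w e 1) a b c y j) +
      ∑ i : Fin 15, ∑ j : Fin 15, (κ i j : ℝ) * cell (Function.update w e 1) a b c y i * cell (Function.update w e 0) a b c y j) := by
  classical
  rw [mix_eq_fibres]
  refine Finset.sum_nonneg fun M _ => Finset.sum_nonneg fun C _ => ?_
  refine mul_nonneg (mul_nonneg ?_ ?_) ?_
  · split_ifs <;> norm_num
  · refine Finset.prod_nonneg fun f _ => ?_
    have h0 := (w f).2.1; have h1 := (w f).2.2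
    split_ifs <;> nlinarith
  · have h := fibreCount_nonneg hκ a b c y C ∅ M
    simp only [Finset.empty_union] at h
    exact_mod_cast h

end TwoCopyMono

/-! ## Law level: two-weight monotone `Q44b` and the big-first mixed Bernstein coefficient -/

namespace Q44b

open FourPointAtoms

variable {n : ℕ}

/-- **`Q44b.bil` in cell form** (two weightings): `bil w w' = (cell_w 11 + cell_w 14)·cell_{w'} 0 − Σ_{θ=1}^{9} cell_w(h θ)·cell_{w'}(l θ)`.
[this work] -/
theorem bil_eq_cells (w w' : Sym2 (Fin n) → unitInterval) (a b c y : Fin n) :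
    bil w w' a b c y = (cell w a b c y 11 + cell w a b c y 14) * cell w' a b c y 0 -
      ∑ θ ∈ (Finset.Icc 1 9 : Finset ℕ), cell w a b c y (TwoCopyMono.hIdx θ) * cell w' a b c y (TwoCopyMono.lIdx θ) := by
  have hsum : (∑ θ ∈ (Finset.Icc 1 9 : Finset ℕ), cell w a b c y (TwoCopyMono.hIdx θ) * cell w' a b c y (TwoCopyMono.lIdx θ)) =
      (cell w a b c y 11 + cell w a b c y 6) * (cell w' a b c y 9 + cell w' a b c y 8) +
      cell w a b c y 6 * (cell w' a b c y 1 + cell w' a b c y 10 + cell w' a b c y 7) +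
      cell w a b c y 7 * (cell w' a b c y 5 + cell w' a b c y 4) := by
    have hI : (Finset.Icc 1 9 : Finset ℕ) = {1, 2, 3, 4, 5, 6, 7, 8, 9} := by decide
    rw [hI]
    rw [Finset.sum_insert (by decide), Finset.sum_insert (by decide), Finset.sum_insert (by decide), Finset.sum_insert (by decide),
      Finset.sum_insert (by decide), Finset.sum_insert (by decide), Finset.sum_insert (by decide), Finset.sum_insert (by decide),
      Finset.sum_singleton]
    simp only [TwoCopyMono.hIdx, TwoCopyMono.lIdx]
    norm_num
    ring
  rw [hsum]
  unfold bil
  rw [real_evAC, real_evEmp, real_evAD, real_evX, real_evAB, real_evCnA, real_evPend, real_evXp]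
  ring

/-- **Two-weight monotone `Q44b` (all `n`).**  For every `n`, all vertices `a b c y` and all weightings `w' ≤ w` of the pairs of `Fin n`:
`0 ≤ Q44b.bil w w' a b c y = P_w(AC)·P_{w'}(∅) − P_w(AΔ)·P_{w'}(X) − P_w(ab|c|y)·P_{w'}(C¬A) − P_w(a|bcy)·P_{w'}(X′)`
— the heavy events at the bigger weights.  (`w' = w` is `Q44b.row_nonneg_all`.) [this work] -/
theorem bil_nonneg_of_le (w w' : Sym2 (Fin n) → unitInterval) (hle : ∀ e, w' e ≤ w e) (a b c y : Fin n) :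
    0 ≤ bil w w' a b c y := by
  have hS : ∀ θ ∈ (Finset.Icc 1 9 : Finset ℕ), 1 ≤ θ ∧ θ ≤ 9 := fun θ hθ => Finset.mem_Icc.1 hθ
  have h := TwoCopyMono.q44b_pack_twoWeight (Finset.Icc 1 9) hS w w' hle a b c y
  rw [bil_eq_cells]
  linarith

/-- **The big-first mixed Bernstein coefficient is nonnegative at every pair.**  For every finite weighted graph `(Fin n, w)`, all
`a b c y` and EVERY pair `e`: `0 ≤ B₁₀(e) = Q44b.bil (w[e↦1]) (w[e↦0]) a b c y` (the coefficient of `t(1−t)` with the contracted copy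
in the heavy slot, `Q44b.row_oneBond`). [this work] -/
theorem bigFirst_nonneg (w : Sym2 (Fin n) → unitInterval) (e : Sym2 (Fin n)) (a b c y : Fin n) :
    0 ≤ bil (Function.update w e 1) (Function.update w e 0) a b c y := by
  refine bil_nonneg_of_le _ _ (fun e' => ?_) a b c y
  by_cases h : e' = e
  · subst h; simp only [Function.update_self]; exact unitInterval.nonneg _
  · simp only [Function.update_of_ne h]; exact le_rfl


/-- **The mixed Bernstein coefficient of the `Q44b` pencil is nonnegative at EVERY pair** (`MIX(e) = B₀₁ + B₁₀ ≥ 0`; ttrl3 MIX-SECTORS: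
0 / 17.1·10⁹ exact instances; now kernel): for every finite weighted graph `(Fin n, w)`, all `a b c y` and every pair `e`,
`0 ≤ bil (w[e↦0]) (w[e↦1]) + bil (w[e↦1]) (w[e↦0])`. [this work] -/
theorem mix_nonneg (w : Sym2 (Fin n) → unitInterval) (e : Sym2 (Fin n)) (a b c y : Fin n) :
    0 ≤ bil (Function.update w e 0) (Function.update w e 1) a b c y +
      bil (Function.update w e 1) (Function.update w e 0) a b c y := by
  have hS : ∀ θ ∈ (Finset.Icc 1 9 : Finset ℕ), 1 ≤ θ ∧ θ ≤ 9 := fun θ hθ => Finset.mem_Icc.1 hθ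
  have h := TwoCopyMono.mix_cell_nonneg (TwoCopyMono.kerS_twoMap_prof (Finset.Icc 1 9) hS) w e a b c y
  rw [TwoCopyMono.sum_kerS_cell₂ _ hS, TwoCopyMono.sum_kerS_cell₂ _ hS] at h
  rw [bil_eq_cells, bil_eq_cells]
  linarith

/-- `PencilMixed w e a b c y` holds unconditionally (the mixed coefficient is nonnegative regardless of the ends). [this work] -/
theorem pencilMixed_holds (w : Sym2 (Fin n) → unitInterval) (e : Sym2 (Fin n)) (a b c y : Fin n) : PencilMixed w e a b c y :=
  fun _ _ => mix_nonneg w e a b c y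

/-- **`MIXany` holds** (gen 8 hypothesis of `row_nonneg_of_mixedAny`, discharged). [this work] -/
theorem mixAny_holds (a b c y : Fin n) : MIXany n a b c y :=
  fun w e _ _ => pencilMixed_holds w e a b c y

/-- **`MIXa` holds** (gen 8 hypothesis of `row_nonneg_of_mixedAt`, discharged). [this work] -/
theorem mixa_holds (a b c y : Fin n) : MIXa n a b c y :=
  fun w x z _ _ _ => pencilMixed_holds w s(x, z) a b c y

/-- **`MIXint` holds** (gen 12 hypothesis of `row_nonneg_of_mixInt`, discharged). [this work] -/
theorem mixInt_holds (a b c y : Fin n) : MIXint n a b c y :=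
  fun w x z _ _ _ _ _ _ => pencilMixed_holds w s(x, z) a b c y

/-- `Q44b ∀n` once more, through the (now unconditional) mixed pencil route of gen 8/12 (consistency check). [this work] -/
theorem row_nonneg_via_mix (w : Sym2 (Fin n) → unitInterval) (a b c y : Fin n) : 0 ≤ row w a b c y := row_nonneg_of_mixInt a b c y (mixInt_holds a b c y) w

end Q44b
end Summit.CriticalPhenomena.PercolationContinuityZ3.Theorems

end
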